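import Summits.ResolutionOfSingularities.ResolutionOfSingularities.Theorems.MarkedTransferCampaignW46FiniteExitBoundTransform
import HarnessLib

/-!
# [OURS · L1 W4.6, rung (i) — the dictionary, SCHEME HALF, brick 27] A point of a blowing up over a regular closed
# point is DETERMINED by its chart index and its residues: two points with congruent chart data coincide

Cell res-hironaka (LADDER-RESOLUTION rung L, D-0089), slot W4.6 «restricted regimes as rungs», seat res-L1-s46-pv-2
(gen 5: the GEOMETRIC upgrade of the forced-atom rung — finitely many singular points instead of one). Host: route
`WildCones`, crux `ClassicalRegimes` (stmt-ResolutionOfSingularities-16884), `--supports … --as helper`.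

HONEST FRAMING. Everything here is OURS: subring bookkeeping in the function field over the tree's blow-up library
(`IsBlowup.stalkEmb`/`fibreSubalgebra`, `IsQuadraticTransform`, `blowupRing`) and res-L1-s46-pv-9's
`CampaignW46.eq_of_fibreSubalgebra_eq` / `isQuadraticTransform_fibreSubalgebra'`. NOTHING here is a statement of
H. Hironaka's manuscript [Hironaka2017]; no FACT-LIST premise. AI review is weaker than expert review.

## What is proved (`eq_of_chartData_congr`)

Let `π : Z′ → Z` be a blowing up (`IsBlowup π J`) of integral locally Noetherian schemes with `J_ξ = 𝔪_ξ = (c_j)_j`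
(blow-up of the closed point `ξ`), and `ξ₁, ξ₂ ∈ Z′` over `ξ` carrying CHART DATA WITH THE SAME INDEX `i` AND CONGRUENT
RESIDUES: ring maps `g_k : 𝒪_{Z,ξ} → 𝒪_{Z′,ξ_k}` with `ε_{ξ_k} ∘ g_k = (𝒪_{Z,ξ} ⊆ K(Z))`, quotients `e_k j` with
`g_k(c_j) = g_k(c_i) · e_k j`, lifts `τ_k j ∈ 𝒪_{Z,ξ}` with `e_k j − g_k(τ_k j) ∈ 𝔪_{ξ_k}` and `τ₁ j − τ₂ j ∈ 𝔪_ξ`.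
Then **`ξ₁ = ξ₂`**. Proof (`subring_le_of_chartData_congr`, field arithmetic in `K(Z)`): with `R = 𝒪_{Z,ξ}`,
`S_k = ε(𝒪_{Z′,ξ_k})` (local, dominating `R`; `S₁` a quadratic transform `= (R[𝔪/x])_𝔫`), `q_j = c_j/c_i` and
`B = R[q_j]`: every element of `B` is ≡ an element of `R` modulo `𝔪_{S₁} ∩ 𝔪_{S₂}`; `z ∈ S₁` is `a/b` over `R[𝔪/x]`
with `b` a unit of `S₁`, and rescaling by the units `c_i/x`, `x/c_i` gives `z = a″/b″` over `B ⊆ S₂` with `b″` a unit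
of `S₁`, `b″ = r + m`, `r` a unit of `S₁` hence of `R` hence of `S₂`, so `b″` is a unit of `S₂` and `z ∈ S₂`;
symmetrically `S₁ = S₂`, and `eq_of_fibreSubalgebra_eq` (separatedness) ends. ROLE: injectivity half of «points over `ξ`
↔ directions», used by the finite-`Sing` forced-atom rung to COUNT singular points of the transform by chart data.
References: Stacks Project Tags 0804, 01KM [StacksProject]; S. D. Cutkosky, *Resolution of Singularities* (2004) §2.1
[Cutkosky2014]; H. Hironaka, ms. 2017, Th. 16.6 p.84 — ROLE of «the closed points `ξ′ ∈ π⁻¹(ξ)`» only, under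
adjudication, not cited as fact. [folklore]
-/

noncomputable section

-- single-problem summit: the doubled namespace component `ResolutionOfSingularities` is forced
set_option linter.dupNamespace false

open CategoryTheory AlgebraicGeometry TopologicalSpace IsLocalRing

namespace Summit.ResolutionOfSingularities.ResolutionOfSingularities.Theorems

namespace CampaignW46.ChartPoint

open Literature.AlgebraicGeometry.Resolution

universe u

/-! ## Local subrings of a field: units and maximal ideals read in the field -/

section SubringLemmas

variable {K : Type u} [Field K]

/-- An element of a local subring lies in the maximal ideal iff it is not a unit of the subring, i.e. iff it is
`0` or its inverse is not in the subring. [folklore] -/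
theorem mk_mem_maximalIdeal_iff {S : Subring K} [IsLocalRing S] {z : K} (hz : z ∈ S) :
    (⟨z, hz⟩ : S) ∈ maximalIdeal S ↔ ¬ (z ≠ 0 ∧ z⁻¹ ∈ S) := by
  rw [mem_maximalIdeal, mem_nonunits_iff, isUnit_subring_iff_inv_mem]

/-- Domination transports non-units: if `S` dominates `R` then `𝔪_R ⊆ 𝔪_S`. [cite: Cutkosky2014, §2.1] -/
theorem mk_mem_maximalIdeal_of_dominates {R S : Subring K} [IsLocalRing R] [IsLocalRing S] (h : SubringDominates R S)
    {r : K} (hr : r ∈ R) (hm : (⟨r, hr⟩ : R) ∈ maximalIdeal R) : (⟨r, h.1 hr⟩ : S) ∈ maximalIdeal S := by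
  rw [mk_mem_maximalIdeal_iff] at hm ⊢
  rintro ⟨h0, hinv⟩
  exact hm ⟨h0, h.2 r hr hinv⟩

/-- **The subring inclusion from congruent chart data** (pure field arithmetic; see the module docstring). `R`, `S₁`,
`S₂` local subrings of a field `K`, `S₁` a quadratic transform of `R` and `S₂` dominating `R`; `cᵢ ∈ 𝔪_R` non-zero;
elements `q_j ∈ S₁ ∩ S₂` such that `𝔪_R/cᵢ ⊆ B := R[q_j : j]`; and elements `τ₁ j, τ₂ j ∈ R` with `q_j − τ_k j ∈ 𝔪_{S_k}`
and `τ₁ j − τ₂ j ∈ 𝔪_R`. Then `S₁ ≤ S₂`. [cite: Cutkosky2014, §2.1] -/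
theorem subring_le_of_chartData_congr {R S₁ S₂ : Subring K} [IsLocalRing R] [IsLocalRing S₁] [IsLocalRing S₂]
    (hQT : IsQuadraticTransform R S₁) (hdom₂ : SubringDominates R S₂)
    {ci : K} (hciR : ci ∈ R) (hci0 : ci ≠ 0) (hci𝔪 : (⟨ci, hciR⟩ : R) ∈ maximalIdeal R)
    {σ : Type*} (q : σ → K) (hq₁ : ∀ j, q j ∈ S₁) (hq₂ : ∀ j, q j ∈ S₂)
    (hgen : ∀ m : R, m ∈ maximalIdeal R → (m : K) / ci ∈ Subring.closure ((R : Set K) ∪ Set.range q))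
    (τ₁ τ₂ : σ → K) (hτ₁ : ∀ j, τ₁ j ∈ R) (hτ₂ : ∀ j, τ₂ j ∈ R)
    (hcongr : ∀ j, (⟨τ₁ j - τ₂ j, sub_mem (hτ₁ j) (hτ₂ j)⟩ : R) ∈ maximalIdeal R)
    (hm₁ : ∀ j, (⟨q j - τ₁ j, sub_mem (hq₁ j) (hQT.dominates.1 (hτ₁ j))⟩ : S₁) ∈ maximalIdeal S₁)
    (hm₂ : ∀ j, (⟨q j - τ₂ j, sub_mem (hq₂ j) (hdom₂.1 (hτ₂ j))⟩ : S₂) ∈ maximalIdeal S₂) :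
    S₁ ≤ S₂ := by
  classical
  -- in a local ring a unit plus an element of the maximal ideal is a unit (tree: `CampaignW46.Cusp.isUnit_add_of_mem`)
  have isUnit_add_of_mem_maximalIdeal : ∀ {S : Subring K} [IsLocalRing S] {a m : S}, IsUnit a →
      m ∈ maximalIdeal S → IsUnit (a + m) := fun {S} _ {a m} ha hm => by
    by_contra h
    have h2 : a ∈ maximalIdeal S := by
      have := sub_mem ((mem_maximalIdeal _).mpr (mem_nonunits_iff.mpr h)) hm
      rwa [add_sub_cancel_right] at this
    exact (mem_nonunits_iff.mp ((mem_maximalIdeal _).mp h2)) ha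
  have hdom₁ : SubringDominates R S₁ := hQT.dominates
  have hRS₁ : R ≤ S₁ := hdom₁.1
  have hRS₂ : R ≤ S₂ := hdom₂.1
  set B : Subring K := Subring.closure ((R : Set K) ∪ Set.range q) with hB
  have hBS₁ : B ≤ S₁ :=
    Subring.closure_le.mpr (Set.union_subset hRS₁ (Set.range_subset_iff.mpr hq₁))
  have hBS₂ : B ≤ S₂ :=
    Subring.closure_le.mpr (Set.union_subset hRS₂ (Set.range_subset_iff.mpr hq₂))
  -- (b) every element of `B` is an element of `R` plus an element of `𝔪_{S₁} ∩ 𝔪_{S₂}`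
  have approx : ∀ y ∈ B, ∃ r : K, r ∈ R ∧
      (∃ h₁ : y - r ∈ S₁, (⟨y - r, h₁⟩ : S₁) ∈ maximalIdeal S₁) ∧
      (∃ h₂ : y - r ∈ S₂, (⟨y - r, h₂⟩ : S₂) ∈ maximalIdeal S₂) := by
    intro y hy
    induction hy using Subring.closure_induction with
    | mem y hy =>
      rcases hy with hyR | ⟨j, rfl⟩
      · exact ⟨y, hyR, ⟨by rw [sub_self]; exact zero_mem _, by simp only [sub_self]; exact zero_mem _⟩,
          ⟨by rw [sub_self]; exact zero_mem _, by simp only [sub_self]; exact zero_mem _⟩⟩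
      · refine ⟨τ₁ j, hτ₁ j, ⟨_, hm₁ j⟩, ?_⟩
        have hmem : q j - τ₁ j ∈ S₂ := sub_mem (hq₂ j) (hRS₂ (hτ₁ j))
        refine ⟨hmem, ?_⟩
        have hsplit : (⟨q j - τ₁ j, hmem⟩ : S₂) =
            ⟨q j - τ₂ j, sub_mem (hq₂ j) (hRS₂ (hτ₂ j))⟩ + ⟨-(τ₁ j - τ₂ j), neg_mem (hRS₂ (sub_mem (hτ₁ j) (hτ₂ j)))⟩ :=
          Subtype.ext (by push_cast; ring)
        rw [hsplit]
        refine add_mem (hm₂ j) ?_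
        have hneg : (⟨-(τ₁ j - τ₂ j), neg_mem (hRS₂ (sub_mem (hτ₁ j) (hτ₂ j)))⟩ : S₂) =
            -⟨τ₁ j - τ₂ j, hRS₂ (sub_mem (hτ₁ j) (hτ₂ j))⟩ := Subtype.ext rfl
        rw [hneg]
        exact neg_mem (mk_mem_maximalIdeal_of_dominates hdom₂ _ (hcongr j))
    | zero => exact ⟨0, zero_mem _, ⟨by rw [sub_self]; exact zero_mem _, by simp only [sub_self]; exact zero_mem _⟩,
        ⟨by rw [sub_self]; exact zero_mem _, by simp only [sub_self]; exact zero_mem _⟩⟩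
    | one => exact ⟨1, one_mem _, ⟨by rw [sub_self]; exact zero_mem _, by simp only [sub_self]; exact zero_mem _⟩,
        ⟨by rw [sub_self]; exact zero_mem _, by simp only [sub_self]; exact zero_mem _⟩⟩
    | add y y' hy hy' ih ih' =>
      obtain ⟨r, hrR, ⟨h₁, hm1⟩, ⟨h₂, hm2⟩⟩ := ih
      obtain ⟨r', hr'R, ⟨h₁', hm1'⟩, ⟨h₂', hm2'⟩⟩ := ih'
      have e : y + y' - (r + r') = (y - r) + (y' - r') := by ring
      refine ⟨r + r', add_mem hrR hr'R, ⟨by rw [e]; exact add_mem h₁ h₁', ?_⟩, ⟨by rw [e]; exact add_mem h₂ h₂', ?_⟩⟩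
      · rw [show (⟨y + y' - (r + r'), by rw [e]; exact add_mem h₁ h₁'⟩ : S₁) = ⟨y - r, h₁⟩ + ⟨y' - r', h₁'⟩ from
          Subtype.ext e]; exact add_mem hm1 hm1'
      · rw [show (⟨y + y' - (r + r'), by rw [e]; exact add_mem h₂ h₂'⟩ : S₂) = ⟨y - r, h₂⟩ + ⟨y' - r', h₂'⟩ from
          Subtype.ext e]; exact add_mem hm2 hm2'
    | neg y hy ih =>
      obtain ⟨r, hrR, ⟨h₁, hm1⟩, ⟨h₂, hm2⟩⟩ := ih
      have e : -y - -r = -(y - r) := by ring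
      refine ⟨-r, neg_mem hrR, ⟨by rw [e]; exact neg_mem h₁, ?_⟩, ⟨by rw [e]; exact neg_mem h₂, ?_⟩⟩
      · rw [show (⟨-y - -r, by rw [e]; exact neg_mem h₁⟩ : S₁) = -⟨y - r, h₁⟩ from Subtype.ext e]; exact neg_mem hm1
      · rw [show (⟨-y - -r, by rw [e]; exact neg_mem h₂⟩ : S₂) = -⟨y - r, h₂⟩ from Subtype.ext e]; exact neg_mem hm2
    | mul y y' hy hy' ih ih' =>
      obtain ⟨r, hrR, ⟨h₁, hm1⟩, ⟨h₂, hm2⟩⟩ := ih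
      obtain ⟨r', hr'R, ⟨h₁', hm1'⟩, ⟨h₂', hm2'⟩⟩ := ih'
      have e : y * y' - r * r' = (y - r) * y' + r * (y' - r') := by ring
      have hy'₁ : y' ∈ S₁ := hBS₁ hy'
      have hy'₂ : y' ∈ S₂ := hBS₂ hy'
      refine ⟨r * r', mul_mem hrR hr'R,
        ⟨by rw [e]; exact add_mem (mul_mem h₁ hy'₁) (mul_mem (hRS₁ hrR) h₁'), ?_⟩,
        ⟨by rw [e]; exact add_mem (mul_mem h₂ hy'₂) (mul_mem (hRS₂ hrR) h₂'), ?_⟩⟩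
      · rw [show (⟨y * y' - r * r', by rw [e]; exact add_mem (mul_mem h₁ hy'₁) (mul_mem (hRS₁ hrR) h₁')⟩ : S₁) =
            ⟨y - r, h₁⟩ * ⟨y', hy'₁⟩ + ⟨r, hRS₁ hrR⟩ * ⟨y' - r', h₁'⟩ from Subtype.ext e]
        exact add_mem (Ideal.mul_mem_right _ _ hm1) (Ideal.mul_mem_left _ _ hm1')
      · rw [show (⟨y * y' - r * r', by rw [e]; exact add_mem (mul_mem h₂ hy'₂) (mul_mem (hRS₂ hrR) h₂')⟩ : S₂) =
            ⟨y - r, h₂⟩ * ⟨y', hy'₂⟩ + ⟨r, hRS₂ hrR⟩ * ⟨y' - r', h₂'⟩ from Subtype.ext e]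
        exact add_mem (Ideal.mul_mem_right _ _ hm2) (Ideal.mul_mem_left _ _ hm2')
  -- (c) the quadratic transform datum of `S₁`: `x`, the ring `B_x = R[𝔪/x] ≤ S₁` and fractions over it
  obtain ⟨_, x, hx𝔪, hx0, _, hBx, hfrac, -⟩ := hQT
  have hxK0 : (x : K) ≠ 0 := fun h => hx0 (Subtype.ext h)
  -- `u = cᵢ/x ∈ B_x ≤ S₁` and `w = x/cᵢ ∈ B`, with `u w = 1`
  set u : K := ci / (x : K) with hu
  set w : K := (x : K) / ci with hw
  have huBx : u ∈ blowupRing R (x : K) := div_mem_blowupRing (x : K) (y := ⟨ci, hciR⟩) hci𝔪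
  have huS₁ : u ∈ S₁ := hBx huBx
  have hwB : w ∈ B := hgen x hx𝔪
  have huw : u * w = 1 := by
    rw [hu, hw, div_mul_div_comm, mul_comm ci, div_self (mul_ne_zero hxK0 hci0)]
  have hwu : w * u = 1 := by rw [mul_comm, huw]
  -- (d) every element of `B_x` is an element of `B` times a power of `u`
  have convert : ∀ y ∈ blowupRing R (x : K), ∃ (N : ℕ) (y' : K), y' ∈ B ∧ y = y' * u ^ N := by
    intro y hy
    unfold blowupRing at hy
    induction hy using Subring.closure_induction with
    | mem y hy =>
      rcases hy with hyR | ⟨m, hm, rfl⟩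
      · exact ⟨0, y, Subring.subset_closure (Or.inl hyR), by rw [pow_zero, mul_one]⟩
      · refine ⟨1, (m : K) / ci, hgen m hm, ?_⟩
        rw [pow_one, hu, div_mul_div_comm, mul_comm ci, ← div_mul_div_comm, div_self hci0, mul_one]
    | zero => exact ⟨0, 0, zero_mem _, by rw [zero_mul]⟩
    | one => exact ⟨0, 1, one_mem _, by rw [pow_zero, mul_one]⟩
    | add y y' _ _ ih ih' =>
      obtain ⟨N, a, haB, rfl⟩ := ih
      obtain ⟨N', a', ha'B, rfl⟩ := ih'
      refine ⟨N + N', a * w ^ N' + a' * w ^ N, add_mem (mul_mem haB (pow_mem hwB _)) (mul_mem ha'B (pow_mem hwB _)), ?_⟩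
      have h1 : a * u ^ N = a * w ^ N' * u ^ (N + N') := by
        rw [pow_add, show a * w ^ N' * (u ^ N * u ^ N') = a * u ^ N * (w * u) ^ N' by rw [mul_pow]; ring, hwu,
          one_pow, mul_one]
      have h2 : a' * u ^ N' = a' * w ^ N * u ^ (N + N') := by
        rw [pow_add, show a' * w ^ N * (u ^ N * u ^ N') = a' * u ^ N' * (w * u) ^ N by rw [mul_pow]; ring, hwu,
          one_pow, mul_one]
      rw [h1, h2, add_mul]
    | neg y _ ih =>
      obtain ⟨N, a, haB, rfl⟩ := ih
      exact ⟨N, -a, neg_mem haB, by rw [neg_mul]⟩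
    | mul y y' _ _ ih ih' =>
      obtain ⟨N, a, haB, rfl⟩ := ih
      obtain ⟨N', a', ha'B, rfl⟩ := ih'
      exact ⟨N + N', a * a', mul_mem haB ha'B, by rw [pow_add]; ring⟩
  -- (e) the inclusion
  intro z hz
  obtain ⟨a, ha, b, hb, hbinv, hzab⟩ := hfrac z hz
  by_cases hb0 : b = 0
  · rw [hzab, hb0, div_zero]
    exact zero_mem _
  obtain ⟨Na, a', ha'B, rfl⟩ := convert a ha
  obtain ⟨Nb, b', hb'B, rfl⟩ := convert b hb
  -- rescaled numerator and denominator in `B`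
  set a'' : K := a' * w ^ Nb with ha''
  set b'' : K := b' * w ^ Na with hb''
  have ha''B : a'' ∈ B := mul_mem ha'B (pow_mem hwB _)
  have hb''B : b'' ∈ B := mul_mem hb'B (pow_mem hwB _)
  -- `b″ · u^(Na+Nb) = b`, so `b″` is a unit of `S₁`
  have hb''u : b'' * u ^ (Na + Nb) = b' * u ^ Nb := by
    rw [hb'', pow_add, mul_assoc, ← mul_assoc (w ^ Na), ← mul_pow, hwu, one_pow, one_mul]
  have hb''0 : b'' ≠ 0 := fun h => hb0 (by rw [← hb''u, h, zero_mul])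
  have hb''inv : b''⁻¹ = (b' * u ^ Nb)⁻¹ * u ^ (Na + Nb) := by
    have key : b'' * ((b' * u ^ Nb)⁻¹ * u ^ (Na + Nb)) = 1 := by
      calc b'' * ((b' * u ^ Nb)⁻¹ * u ^ (Na + Nb)) = (b'' * u ^ (Na + Nb)) * (b' * u ^ Nb)⁻¹ := by ring
        _ = 1 := by rw [hb''u, mul_inv_cancel₀ hb0]
    exact (eq_inv_of_mul_eq_one_right key).symm
  have hb''invS₁ : b''⁻¹ ∈ S₁ := by
    rw [hb''inv]
    exact mul_mem hbinv (pow_mem huS₁ _)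
  -- `z = a″ / b″`
  have hz' : z = a'' / b'' := by
    rw [hzab, ha'', hb'']
    have hbu0 : b' * u ^ Nb ≠ 0 := hb0
    rw [div_eq_div_iff hbu0 (by rw [← hb'']; exact hb''0)]
    -- `a' u^Na · (b' w^Na) = a' w^Nb · (b' u^Nb)`
    have h1 : u ^ Na * w ^ Na = 1 := by rw [← mul_pow, huw, one_pow]
    have h2 : w ^ Nb * u ^ Nb = 1 := by rw [← mul_pow, hwu, one_pow]
    calc a' * u ^ Na * (b' * w ^ Na) = a' * b' * (u ^ Na * w ^ Na) := by ring
      _ = a' * b' := by rw [h1, mul_one]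
      _ = a' * b' * (w ^ Nb * u ^ Nb) := by rw [h2, mul_one]
      _ = a' * w ^ Nb * (b' * u ^ Nb) := by ring
  -- `b″ = r + m` with `r ∈ R`, `m ∈ 𝔪_{S₁} ∩ 𝔪_{S₂}`; `r` is a unit of `S₁`, hence of `R`, hence of `S₂`
  obtain ⟨r, hrR, ⟨hm₁S, hm₁⟩, ⟨hm₂S, hm₂'⟩⟩ := approx b'' hb''B
  have hb''unit₁ : IsUnit (⟨b'', hBS₁ hb''B⟩ : S₁) := (isUnit_subring_iff_inv_mem _).mpr ⟨hb''0, hb''invS₁⟩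
  have hrunit₁ : IsUnit (⟨r, hRS₁ hrR⟩ : S₁) := by
    rw [show (⟨r, hRS₁ hrR⟩ : S₁) = ⟨b'', hBS₁ hb''B⟩ + -⟨b'' - r, hm₁S⟩ from Subtype.ext (by push_cast; ring)]
    exact isUnit_add_of_mem_maximalIdeal hb''unit₁ (neg_mem hm₁)
  obtain ⟨hr0, hrinv₁⟩ := (isUnit_subring_iff_inv_mem _).mp hrunit₁
  have hrunit₂ : IsUnit (⟨r, hRS₂ hrR⟩ : S₂) := (isUnit_subring_iff_inv_mem _).mpr ⟨hr0, hRS₂ (hdom₁.2 r hrR hrinv₁)⟩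
  have hb''unit₂ : IsUnit (⟨b'', hBS₂ hb''B⟩ : S₂) := by
    rw [show (⟨b'', hBS₂ hb''B⟩ : S₂) = ⟨r, hRS₂ hrR⟩ + ⟨b'' - r, hm₂S⟩ from Subtype.ext (by push_cast; ring)]
    exact isUnit_add_of_mem_maximalIdeal hrunit₂ hm₂'
  rw [hz', div_eq_mul_inv]
  exact mul_mem (hBS₂ ha''B) ((isUnit_subring_iff_inv_mem _).mp hb''unit₂).2

end SubringLemmas

/-! ## The scheme statement: points over `ξ` with congruent chart data coincide -/

section Scheme

variable {Z Z' : Scheme.{u}} [IsIntegral Z] [IsIntegral Z'] [IsLocallyNoetherian Z]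
  {π : Z' ⟶ Z} {J : Z.IdealSheafData}

/-- [OURS · L1 W4.6 — DICTIONARY, scheme half, brick 27; replaces the role of «the closed points `ξ′ ∈ π⁻¹(ξ)` of the
blowup with center `ξ`» (H. Hironaka, ms. 2017, Th. 16.6 p.84 l.10) read as «points over `ξ` ARE their chart data»;
NOT a statement of the manuscript] **Two points of a blowing up over a regular closed point with the same chart index
and congruent residues coincide.** See the module docstring for the hypotheses (`g_k` any ring maps
`𝒪_{Z,ξ} → 𝒪_{Z′,ξ_k}` with `ε_{ξ_k} ∘ g_k = (𝒪_{Z,ξ} ⊆ K(Z))`). [cite: StacksProject, Tag 01KM] -/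
theorem eq_of_chartData_congr (hπ : IsBlowup π J) {ξ : Z} (hJ : stalkIdeal J ξ = maximalIdeal (Z.presheaf.stalk ξ))
    {ξ₁ ξ₂ : Z'} (h₁ : π ξ₁ = ξ) (h₂ : π ξ₂ = ξ)
    (g₁ : Z.presheaf.stalk ξ →+* Z'.presheaf.stalk ξ₁) (g₂ : Z.presheaf.stalk ξ →+* Z'.presheaf.stalk ξ₂)
    (hg₁ : ∀ r, hπ.stalkEmb ξ₁ (g₁ r) = algebraMap (Z.presheaf.stalk ξ) Z.functionField r)
    (hg₂ : ∀ r, hπ.stalkEmb ξ₂ (g₂ r) = algebraMap (Z.presheaf.stalk ξ) Z.functionField r)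
    {σ : Type*} (c : σ → Z.presheaf.stalk ξ) (hc : Ideal.span (Set.range c) = maximalIdeal (Z.presheaf.stalk ξ))
    (i : σ) (hci : c i ≠ 0)
    (e₁ : σ → Z'.presheaf.stalk ξ₁) (e₂ : σ → Z'.presheaf.stalk ξ₂)
    (he₁ : ∀ j, g₁ (c j) = g₁ (c i) * e₁ j) (he₂ : ∀ j, g₂ (c j) = g₂ (c i) * e₂ j)
    (τ₁ τ₂ : σ → Z.presheaf.stalk ξ) (hcongr : ∀ j, τ₁ j - τ₂ j ∈ maximalIdeal (Z.presheaf.stalk ξ))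
    (hm₁ : ∀ j, e₁ j - g₁ (τ₁ j) ∈ maximalIdeal (Z'.presheaf.stalk ξ₁))
    (hm₂ : ∀ j, e₂ j - g₂ (τ₂ j) ∈ maximalIdeal (Z'.presheaf.stalk ξ₂)) : ξ₁ = ξ₂ := by
  classical
  -- notation: `ι : 𝒪_{Z,ξ} → K(Z)`, `R = ι(𝒪)`, `S_k = ε(𝒪_{Z′,ξ_k})`
  set ι := algebraMap (Z.presheaf.stalk ξ) Z.functionField with hι
  have hιinj : Function.Injective ι := algebraMap_stalk_functionField_injective ξ
  haveI hRloc : IsLocalRing ι.range := isLocalRing_range_algebraMap_stalk (Z := Z) ξ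
  haveI hS₁loc : IsLocalRing (hπ.fibreSubalgebra ξ ξ₁ h₁).toSubring := hπ.isLocalRing_fibreSubalgebra ξ ξ₁ h₁
  haveI hS₂loc : IsLocalRing (hπ.fibreSubalgebra ξ ξ₂ h₂).toSubring := hπ.isLocalRing_fibreSubalgebra ξ ξ₂ h₂
  have hQT₁ := isQuadraticTransform_fibreSubalgebra' hπ h₁ hJ
  have hQT₂ := isQuadraticTransform_fibreSubalgebra' hπ h₂ hJ
  -- membership in `S_k`
  have memS : ∀ {ξ' : Z'} (h : π ξ' = ξ) (z : Z.functionField),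
      z ∈ (hπ.fibreSubalgebra ξ ξ' h).toSubring ↔ ∃ a, hπ.stalkEmb ξ' a = z := fun h z => by
    rw [Subalgebra.mem_toSubring, hπ.mem_fibreSubalgebra_iff]
  -- the isomorphism `𝒪_{Z′,ξ′} ≅ S_{ξ′}` maps the maximal ideal into the maximal ideal
  have maxS : ∀ {ξ' : Z'} (h : π ξ' = ξ) (y : Z'.presheaf.stalk ξ') (hy : y ∈ maximalIdeal (Z'.presheaf.stalk ξ')),
      haveI := hπ.isLocalRing_fibreSubalgebra ξ ξ' h
      (⟨hπ.stalkEmb ξ' y, (memS h _).mpr ⟨y, rfl⟩⟩ : (hπ.fibreSubalgebra ξ ξ' h).toSubring) ∈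
        maximalIdeal (hπ.fibreSubalgebra ξ ξ' h).toSubring := by
    intro ξ' h y hy
    haveI := hπ.isLocalRing_fibreSubalgebra ξ ξ' h
    have hy' : ¬ IsUnit y := mem_nonunits_iff.mp ((mem_maximalIdeal _).mp hy)
    refine (mem_maximalIdeal _).mpr (mem_nonunits_iff.mpr fun hu => hy' ?_)
    have : (hπ.stalkEquivFibreSubalgebra ξ ξ' h) y =
        (⟨hπ.stalkEmb ξ' y, (hπ.mem_fibreSubalgebra_iff ξ h).mpr ⟨y, rfl⟩⟩ : hπ.fibreSubalgebra ξ ξ' h) := rfl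
    have hu' : IsUnit ((hπ.stalkEquivFibreSubalgebra ξ ξ' h) y) := by rw [this]; exact hu
    exact (MulEquiv.isUnit_map (hπ.stalkEquivFibreSubalgebra ξ ξ' h)).mp hu'
  -- the maximal ideal of `R` is the image of `𝔪_ξ`
  have maxR : ∀ (r : Z.presheaf.stalk ξ), (⟨ι r, ⟨r, rfl⟩⟩ : ι.range) ∈ maximalIdeal ι.range ↔
      r ∈ maximalIdeal (Z.presheaf.stalk ξ) := by
    intro r
    let eR : Z.presheaf.stalk ξ ≃+* ι.range := RingEquiv.ofBijective ι.rangeRestrict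
      ⟨fun _ _ h => hιinj (congrArg Subtype.val h), ι.rangeRestrict_surjective⟩
    have : (⟨ι r, ⟨r, rfl⟩⟩ : ι.range) = eR r := rfl
    rw [this, mem_maximalIdeal, mem_maximalIdeal, mem_nonunits_iff, mem_nonunits_iff, MulEquiv.isUnit_map]
  -- `cᵢ` read in `K(Z)`
  have hci0 : ι (c i) ≠ 0 := (map_ne_zero_iff ι hιinj).mpr hci
  have hci𝔪 : c i ∈ maximalIdeal (Z.presheaf.stalk ξ) := hc ▸ Ideal.subset_span ⟨i, rfl⟩
  -- the quotients `q_j = c_j / cᵢ = ε(e_k j)`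
  set q : σ → Z.functionField := fun j => ι (c j) / ι (c i) with hq
  have hqε : ∀ {ξ' : Z'} (g : Z.presheaf.stalk ξ →+* Z'.presheaf.stalk ξ')
      (hg : ∀ r, hπ.stalkEmb ξ' (g r) = ι r) (e : σ → Z'.presheaf.stalk ξ')
      (he : ∀ j, g (c j) = g (c i) * e j) (j : σ), hπ.stalkEmb ξ' (e j) = q j := by
    intro ξ' g hg e he j
    have h := congrArg (hπ.stalkEmb ξ') (he j)
    rw [map_mul, hg, hg] at h
    rw [hq]
    field_simp
    rw [h, mul_comm]
  have hq₁ : ∀ j, q j ∈ (hπ.fibreSubalgebra ξ ξ₁ h₁).toSubring := fun j =>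
    (memS h₁ _).mpr ⟨e₁ j, hqε g₁ hg₁ e₁ he₁ j⟩
  have hq₂ : ∀ j, q j ∈ (hπ.fibreSubalgebra ξ ξ₂ h₂).toSubring := fun j =>
    (memS h₂ _).mpr ⟨e₂ j, hqε g₂ hg₂ e₂ he₂ j⟩
  -- `𝔪_R / cᵢ ⊆ B = R[q]`
  have hgen : ∀ m : ι.range, m ∈ maximalIdeal ι.range →
      (m : Z.functionField) / ι (c i) ∈ Subring.closure ((ι.range : Set Z.functionField) ∪ Set.range q) := by
    rintro ⟨_, ⟨m₀, rfl⟩⟩ hm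
    have hm₀ : m₀ ∈ Ideal.span (Set.range c) := by rw [hc]; exact (maxR m₀).mp hm
    change ι m₀ / ι (c i) ∈ _
    clear hm
    induction hm₀ using Submodule.span_induction with
    | mem y hy =>
      obtain ⟨j, rfl⟩ := hy
      exact Subring.subset_closure (Or.inr ⟨j, rfl⟩)
    | zero => rw [map_zero, zero_div]; exact zero_mem _
    | add y y' _ _ ih ih' => rw [map_add, add_div]; exact add_mem ih ih'
    | smul r y _ ih =>
      rw [smul_eq_mul, map_mul, mul_div_assoc]
      exact mul_mem (Subring.subset_closure (Or.inl ⟨r, rfl⟩)) ih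
  -- the lifts read in `K(Z)`
  have hτR : ∀ (τ : σ → Z.presheaf.stalk ξ) (j : σ), ι (τ j) ∈ ι.range := fun τ j => ⟨τ j, rfl⟩
  have hcongr' : ∀ j, (⟨ι (τ₁ j) - ι (τ₂ j), sub_mem (hτR τ₁ j) (hτR τ₂ j)⟩ : ι.range) ∈ maximalIdeal ι.range := by
    intro j
    have : (⟨ι (τ₁ j) - ι (τ₂ j), sub_mem (hτR τ₁ j) (hτR τ₂ j)⟩ : ι.range) = ⟨ι (τ₁ j - τ₂ j), ⟨_, rfl⟩⟩ :=
      Subtype.ext (map_sub ι _ _).symm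
    rw [this]
    exact (maxR _).mpr (hcongr j)
  have hmS : ∀ {ξ' : Z'} (h : π ξ' = ξ) (g : Z.presheaf.stalk ξ →+* Z'.presheaf.stalk ξ')
      (hg : ∀ r, hπ.stalkEmb ξ' (g r) = ι r) (e : σ → Z'.presheaf.stalk ξ')
      (he : ∀ j, g (c j) = g (c i) * e j) (τ : σ → Z.presheaf.stalk ξ)
      (hm : ∀ j, e j - g (τ j) ∈ maximalIdeal (Z'.presheaf.stalk ξ')) (j : σ)
      (hmem : q j - ι (τ j) ∈ (hπ.fibreSubalgebra ξ ξ' h).toSubring),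
      haveI := hπ.isLocalRing_fibreSubalgebra ξ ξ' h
      (⟨q j - ι (τ j), hmem⟩ : (hπ.fibreSubalgebra ξ ξ' h).toSubring) ∈
        maximalIdeal (hπ.fibreSubalgebra ξ ξ' h).toSubring := by
    intro ξ' h g hg e he τ hm j hmem
    have hval : hπ.stalkEmb ξ' (e j - g (τ j)) = q j - ι (τ j) := by
      rw [map_sub, hqε g hg e he j, hg]
    have := maxS h _ (hm j)
    simp only [hval] at this
    exact this
  -- the two inclusions
  have le₁₂ : (hπ.fibreSubalgebra ξ ξ₁ h₁).toSubring ≤ (hπ.fibreSubalgebra ξ ξ₂ h₂).toSubring :=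
    subring_le_of_chartData_congr hQT₁ hQT₂.dominates ⟨c i, rfl⟩ hci0 ((maxR _).mpr hci𝔪) q hq₁ hq₂ hgen
      (fun j => ι (τ₁ j)) (fun j => ι (τ₂ j)) (hτR τ₁) (hτR τ₂) hcongr'
      (fun j => hmS h₁ g₁ hg₁ e₁ he₁ τ₁ hm₁ j _) (fun j => hmS h₂ g₂ hg₂ e₂ he₂ τ₂ hm₂ j _)
  have hcongr'' : ∀ j, (⟨ι (τ₂ j) - ι (τ₁ j), sub_mem (hτR τ₂ j) (hτR τ₁ j)⟩ : ι.range) ∈ maximalIdeal ι.range :=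
    fun j => by
    rw [show (⟨ι (τ₂ j) - ι (τ₁ j), sub_mem (hτR τ₂ j) (hτR τ₁ j)⟩ : ι.range) =
        -⟨ι (τ₁ j) - ι (τ₂ j), sub_mem (hτR τ₁ j) (hτR τ₂ j)⟩ from Subtype.ext (by push_cast; ring)]
    exact neg_mem (hcongr' j)
  have le₂₁ : (hπ.fibreSubalgebra ξ ξ₂ h₂).toSubring ≤ (hπ.fibreSubalgebra ξ ξ₁ h₁).toSubring :=
    subring_le_of_chartData_congr hQT₂ hQT₁.dominates ⟨c i, rfl⟩ hci0 ((maxR _).mpr hci𝔪) q hq₂ hq₁ hgen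
      (fun j => ι (τ₂ j)) (fun j => ι (τ₁ j)) (hτR τ₂) (hτR τ₁) hcongr''
      (fun j => hmS h₂ g₂ hg₂ e₂ he₂ τ₂ hm₂ j _) (fun j => hmS h₁ g₁ hg₁ e₁ he₁ τ₁ hm₁ j _)
  exact eq_of_fibreSubalgebra_eq hπ h₁ h₂ (Subalgebra.toSubring_injective (le_antisymm le₁₂ le₂₁))

omit [IsIntegral Z'] in
/-- The structure map `𝒪_{Z,ξ} → 𝒪_{Z′,ξ′}` of a point `ξ′` over `ξ` (stalk map after the identification
`𝒪_{Z,ξ} ≅ 𝒪_{Z,π ξ′}`) is compatible with the canonical embeddings into `K(Z)`. [cite: Kollar2007, §1.4] -/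
theorem stalkEmb_stalkMap_stalkSpecializes (hπ : IsBlowup π J) {ξ : Z} {ξ' : Z'} (h : π ξ' = ξ)
    (r : Z.presheaf.stalk ξ) :
    hπ.stalkEmb ξ' ((π.stalkMap ξ').hom ((Z.presheaf.stalkSpecializes (specializes_of_apply_eq ξ h).1).hom r)) =
      algebraMap (Z.presheaf.stalk ξ) Z.functionField r := by
  rw [hπ.stalkEmb_stalkMap]
  exact RingHom.congr_fun (algebraMap_comp_stalkSpecializes (C := Z) _) r

end Scheme

end CampaignW46.ChartPoint

end Summit.ResolutionOfSingularities.ResolutionOfSingularities.Theorems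

end
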